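import Literature.NumberTheory.Sieve.ChenSwitchedSieve
import Literature.NumberTheory.Sieve.ChenSieveProduct
import Literature.NumberTheory.Sieve.ChenTheoremISieveProduct
import HarnessLib

/-!
# Chen's Theorem I: the sieve step of the switching bound at Chen's level `z = x^{1/10}`

Companion of `ChenTheoremIAssembly.lean`, which assembles Chen's Theorem I
(`P_x(1,2) ≥ 0.67 x C_x/(log x)²`, Sci. Sinica 16 (1973)) from three sieve estimates at Chen's
sieving level `z = x^{1/10}`. The third estimate (hypothesis (C) of
`Literature.NumberTheory.Sieve.Chen.Chen1973_theoremI_of`) is Chen's Lemma 8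
(`Ω ≤ 3.9404 x C_x/(log x)²`, PDF p. 166 of the held copy): an upper bound for the switched count
`S(B, 𝒫, y)`, `B = {N − p₁p₂p₃ : N^{1/10} ≤ p₁ < N^{1/3} ≤ p₂ ≤ p₃}`, `y = N^{1/3}`. It is proved in
three steps exactly as Nathanson's Theorem 10.6 is proved in the tree for `p₁ ≥ N^{1/8}`
(`ChenSwitchedSieve`, `ChenSwitchedRemainder` and the cardinality step): this file is the SIEVE
STEP, a copy of `ChenSwitchedSieve.lean` with the grid of `p₁` started at `N^{1/10}` instead of
`N^{1/8}` (all objects carry the suffix `T`, "tenth"):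

* the grid `ℓ(p) = N^{1/10}(1+ε)^{⌊log(p/N^{1/10})/log(1+ε)⌋}` (`chenGridIndexT`, `chenGridPointT`),
  the enlarged set of triples `T̃(N, ε)` (`switchedTriplesT`: `N^{1/10} ≤ p₁ < y ≤ p₂ ≤ p₃`, `p₁ ∤ N`,
  `(p₂p₃, N) = 1`, `ℓ(p₁)p₂p₃ < N`), the sifted sequence it carries (`switchedSeqT`: weights
  `#{t : |N − p₁p₂p₃| = n}`, density `shiftedPrimesDensity N`, size `#T̃`) and its remainder
  `switchedRemainderT N ε D`;
* `switchedSiftedCount_le_cardT` (`B ⊆ B̃`) and the sieve step `switchedSiftedCount_leT`: for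
  `0 < ε ≤ 1`, `0 < δ ≤ 1/8`, `θ > 0` and all large even `N`,
  `S(B, 𝒫, y) ≤ (2e^γ/(5(1 − 2δ)) + θ) · #T̃(N, ε) · V(N^{1/10}) + R(N, ε, N^{1/2−δ})`
  (uniform linear-sieve upper bound `LinearSieve.upper_explicit` at level `N^{1/2−δ}`,
  `s = 3(1/2 − δ)`, `F(s) = 2e^γ/s`, and `V(y)/V(N^{1/10}) ≤ (3/10)(1 + o(1))` — obtained from
  `V(y) ≤ (3/8 + o(1)) V(N^{1/8})` (`sieveProduct_le_mul_of_le`) and the two Mertens estimates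
  `chen_sieveProduct_estimate_holds` (`N^{1/8}`) and `sieveProduct_tenth_estimate` (`N^{1/10}`),
  `V(N^{1/8})/V(N^{1/10}) → 4/5`; Chen: the factor `8 x C_x/log x` of (27)).

## References

* Chen Jing-run, Sci. Sinica 16 (1973) 157–176, Lemmas 5–8, (26)–(27) (PDF pp. 157–167 of the
  held copy). [ChenSciSinica1973]
* M. B. Nathanson, *Additive Number Theory: The Classical Bases*, GTM 164 (1996), Thm 10.6 and its
  proof, (10.12)–(10.15). [Nathanson1996]
* H. Iwaniec, *Rosser's sieve*, Acta Arith. 36 (1980), 171–202, Theorem 1. [IwaniecActaArith1980]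
-/

open Finset Filter Topology

noncomputable section

namespace Literature.NumberTheory.Sieve.Chen

open SieveSequence

/-! ### The grid of `p₁` started at `N^{1/10}` -/

/-- The grid index of `p`: `k(p) = ⌊log(p/x^{1/10})/log(1+ε)⌋`, so that
`ℓ = x^{1/10}(1+ε)^{k(p)} ≤ p < (1+ε)ℓ` (Nathanson (10.12): `ℓ = z(1+ε)^k`).
[cite: Nathanson1996, Thm 10.6 (proof, (10.12))] -/
def chenGridIndexT (x : ℕ) (ε : ℝ) (p : ℕ) : ℕ :=
  ⌊Real.log ((p : ℝ) / (x : ℝ) ^ (1 / 10 : ℝ)) / Real.log (1 + ε)⌋₊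

/-- The grid point `ℓ(p) = x^{1/10} (1+ε)^{k(p)}` below `p` (Nathanson (10.12)).
[cite: Nathanson1996, Thm 10.6 (proof, (10.12))] -/
def chenGridPointT (x : ℕ) (ε : ℝ) (p : ℕ) : ℝ :=
  (x : ℝ) ^ (1 / 10 : ℝ) * (1 + ε) ^ chenGridIndexT x ε p

/-- `ℓ(p) > 0` for `x ≥ 1`, `ε > 0`. [folklore] -/
theorem chenGridPointT_pos {x : ℕ} {ε : ℝ} (hx : 0 < x) (hε : 0 < ε) (p : ℕ) :
    0 < chenGridPointT x ε p := by
  unfold chenGridPointT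
  have hx0 : (0 : ℝ) < x := by exact_mod_cast hx
  exact mul_pos (Real.rpow_pos_of_pos hx0 _) (pow_pos (by linarith) _)

/-- `ℓ(p) ≤ p` for `p ≥ x^{1/10}`. [cite: Nathanson1996, Thm 10.6 (proof, (10.12))] -/
theorem chenGridPointT_le {x p : ℕ} {ε : ℝ} (hx : 0 < x) (hε : 0 < ε)
    (hp : (x : ℝ) ^ (1 / 10 : ℝ) ≤ p) : chenGridPointT x ε p ≤ p := by
  unfold chenGridPointT chenGridIndexT
  have hx0 : (0 : ℝ) < x := by exact_mod_cast hx
  set z : ℝ := (x : ℝ) ^ (1 / 10 : ℝ) with hz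
  have hz0 : 0 < z := Real.rpow_pos_of_pos hx0 _
  have hp0 : (0 : ℝ) < p := hz0.trans_le hp
  have hlog1 : 0 < Real.log (1 + ε) := Real.log_pos (by linarith)
  set q : ℝ := Real.log ((p : ℝ) / z) / Real.log (1 + ε) with hq
  have hq0 : 0 ≤ q := div_nonneg (Real.log_nonneg (by rwa [le_div_iff₀ hz0, one_mul])) hlog1.le
  have hk : (⌊q⌋₊ : ℝ) ≤ q := Nat.floor_le hq0
  have hpow : (1 + ε) ^ ⌊q⌋₊ ≤ (p : ℝ) / z := by
    rw [← Real.rpow_natCast, Real.rpow_def_of_pos (by linarith)]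
    calc Real.exp (Real.log (1 + ε) * (⌊q⌋₊ : ℝ)) ≤ Real.exp (Real.log (1 + ε) * q) :=
          Real.exp_le_exp.mpr (mul_le_mul_of_nonneg_left hk hlog1.le)
      _ = (p : ℝ) / z := by
          rw [hq, mul_div_cancel₀ _ hlog1.ne', Real.exp_log (div_pos hp0 hz0)]
  calc z * (1 + ε) ^ ⌊q⌋₊ ≤ z * ((p : ℝ) / z) := mul_le_mul_of_nonneg_left hpow hz0.le
    _ = p := mul_div_cancel₀ _ hz0.ne'

/-- `p < (1+ε) ℓ(p)` for `p ≥ x^{1/10}`. [cite: Nathanson1996, Thm 10.6 (proof, (10.12))] -/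
theorem lt_mul_chenGridPointT {x p : ℕ} {ε : ℝ} (hx : 0 < x) (hε : 0 < ε)
    (hp : (x : ℝ) ^ (1 / 10 : ℝ) ≤ p) : (p : ℝ) < (1 + ε) * chenGridPointT x ε p := by
  unfold chenGridPointT chenGridIndexT
  have hx0 : (0 : ℝ) < x := by exact_mod_cast hx
  set z : ℝ := (x : ℝ) ^ (1 / 10 : ℝ) with hz
  have hz0 : 0 < z := Real.rpow_pos_of_pos hx0 _
  have hp0 : (0 : ℝ) < p := hz0.trans_le hp
  have hlog1 : 0 < Real.log (1 + ε) := Real.log_pos (by linarith)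
  set q : ℝ := Real.log ((p : ℝ) / z) / Real.log (1 + ε) with hq
  have hk : q < (⌊q⌋₊ : ℝ) + 1 := Nat.lt_floor_add_one q
  have hpow : (p : ℝ) / z < (1 + ε) ^ (⌊q⌋₊ + 1) := by
    rw [← Real.rpow_natCast, Real.rpow_def_of_pos (by linarith)]
    calc (p : ℝ) / z = Real.exp (Real.log (1 + ε) * q) := by
          rw [hq, mul_div_cancel₀ _ hlog1.ne', Real.exp_log (div_pos hp0 hz0)]
      _ < Real.exp (Real.log (1 + ε) * ((⌊q⌋₊ + 1 : ℕ) : ℝ)) := by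
          rw [Real.exp_lt_exp]
          push_cast
          exact mul_lt_mul_of_pos_left hk hlog1
  rw [div_lt_iff₀ hz0] at hpow
  calc (p : ℝ) < (1 + ε) ^ (⌊q⌋₊ + 1) * z := hpow
    _ = (1 + ε) * (z * (1 + ε) ^ ⌊q⌋₊) := by ring

/-! ### The enlarged set of triples `T̃(N, ε)` -/

/-- The enlarged index set `T̃(N, ε)` of Chen's switched set `B` (Nathanson (10.13)–(10.14), with
the coprimality `(p₁, N) = 1` kept): triples of primes `(p₁, p₂, p₃)`, all `< N`, with
`N^{1/10} ≤ p₁ < N^{1/3} ≤ p₂ ≤ p₃`, `p₁ ∤ N`, `(p₂p₃, N) = 1` and `ℓ(p₁) p₂ p₃ < N`.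
[cite: Nathanson1996, Thm 10.6 (proof, (10.13)–(10.14))] -/
def switchedTriplesT (N : ℕ) (ε : ℝ) : Finset (ℕ × ℕ × ℕ) :=
  (Finset.range N ×ˢ Finset.range N ×ˢ Finset.range N).filter fun t : ℕ × ℕ × ℕ =>
    t.1.Prime ∧ t.2.1.Prime ∧ t.2.2.Prime ∧ (N : ℝ) ^ (1 / 10 : ℝ) ≤ (t.1 : ℝ) ∧ (t.1 : ℝ) < y N ∧
      y N ≤ (t.2.1 : ℝ) ∧ t.2.1 ≤ t.2.2 ∧ ¬t.1 ∣ N ∧ (t.2.1 * t.2.2).Coprime N ∧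
        chenGridPointT N ε t.1 * t.2.1 * t.2.2 < (N : ℝ)

/-- Membership in `T̃(N, ε)`. [folklore] -/
theorem mem_switchedTriplesT {N : ℕ} {ε : ℝ} {t : ℕ × ℕ × ℕ} :
    t ∈ switchedTriplesT N ε ↔ (t.1 < N ∧ t.2.1 < N ∧ t.2.2 < N) ∧
      t.1.Prime ∧ t.2.1.Prime ∧ t.2.2.Prime ∧ (N : ℝ) ^ (1 / 10 : ℝ) ≤ (t.1 : ℝ) ∧ (t.1 : ℝ) < y N ∧
      y N ≤ (t.2.1 : ℝ) ∧ t.2.1 ≤ t.2.2 ∧ ¬t.1 ∣ N ∧ (t.2.1 * t.2.2).Coprime N ∧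
        chenGridPointT N ε t.1 * t.2.1 * t.2.2 < (N : ℝ) := by
  simp only [switchedTriplesT, Finset.mem_filter, Finset.mem_product, Finset.mem_range]

/-- For `t = (p₁, p₂, p₃) ∈ T̃(N, ε)` (`0 < ε ≤ 1`): `p₁p₂p₃ < 2N`, `p₁p₂p₃ ≠ N`, hence
`1 ≤ |N − p₁p₂p₃| ≤ N` (as `p₁ < (1+ε)ℓ(p₁) ≤ 2ℓ(p₁)`, `ℓ(p₁)p₂p₃ < N`, and `(p₂p₃, N) = 1`).
[folklore] -/
theorem tripleDist_pos_and_leT {N : ℕ} {ε : ℝ} (hε : 0 < ε) (hε1 : ε ≤ 1)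
    {t : ℕ × ℕ × ℕ} (ht : t ∈ switchedTriplesT N ε) :
    1 ≤ tripleDist N t ∧ tripleDist N t ≤ N := by
  obtain ⟨⟨hN1, -, -⟩, h₁, h₂, h₃, hz, -, -, -, -, hcop, hlt⟩ := mem_switchedTriplesT.mp ht
  have hNpos : 0 < N := by omega
  -- `p₁p₂p₃ < 2N`
  have hp : (N : ℝ) ^ (1 / 10 : ℝ) ≤ t.1 := hz
  have hltg := lt_mul_chenGridPointT hNpos hε hp
  have hℓ := chenGridPointT_pos hNpos hε t.1
  have h23 : (0 : ℝ) < (t.2.1 : ℝ) * t.2.2 := by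
    have := h₂.pos; have := h₃.pos; positivity
  have h2N : t.1 * t.2.1 * t.2.2 < 2 * N := by
    have hreal : ((t.1 * t.2.1 * t.2.2 : ℕ) : ℝ) < 2 * N := by
      push_cast
      calc (t.1 : ℝ) * t.2.1 * t.2.2 = (t.1 : ℝ) * ((t.2.1 : ℝ) * t.2.2) := by ring
        _ < (1 + ε) * chenGridPointT N ε t.1 * ((t.2.1 : ℝ) * t.2.2) := by gcongr
        _ ≤ 2 * chenGridPointT N ε t.1 * ((t.2.1 : ℝ) * t.2.2) := by gcongr; linarith
        _ = 2 * (chenGridPointT N ε t.1 * t.2.1 * t.2.2) := by ring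
        _ ≤ 2 * N := by linarith
    exact_mod_cast hreal
  -- `p₁p₂p₃ ≠ N`
  have hne : t.1 * t.2.1 * t.2.2 ≠ N := by
    intro h
    have hdvd : t.2.1 * t.2.2 ∣ N := ⟨t.1, by rw [← h]; ring⟩
    have h1 : t.2.1 * t.2.2 = 1 := Nat.Coprime.eq_one_of_dvd hcop hdvd
    have := h₂.two_le
    have := h₃.two_le
    nlinarith
  unfold tripleDist
  constructor
  · rw [Nat.one_le_iff_ne_zero, Ne, Int.natAbs_eq_zero, sub_eq_zero]
    intro h
    exact hne (by exact_mod_cast h.symm)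
  · have key : ((((N : ℤ) - t.1 * t.2.1 * t.2.2).natAbs : ℕ) : ℤ) ≤ N := by
      rw [Int.natCast_natAbs, abs_le]
      have h2N' : ((t.1 * t.2.1 * t.2.2 : ℕ) : ℤ) < 2 * N := by exact_mod_cast h2N
      push_cast at h2N'
      constructor
      · linarith
      · have : (0 : ℤ) ≤ (t.1 : ℤ) * t.2.1 * t.2.2 := by positivity
        linarith
    exact_mod_cast key

/-! ### The sifted sequence carried by `T̃(N, ε)` -/

/-- The weights of the enlarged switched sequence: `a(n) = #{t ∈ T̃(N, ε) : |N − p₁p₂p₃| = n}`.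
[cite: Nathanson1996, Thm 10.6 (proof)] -/
def switchedWeightT (N : ℕ) (ε : ℝ) (n : ℕ) : ℝ :=
  #((switchedTriplesT N ε).filter fun t : ℕ × ℕ × ℕ => tripleDist N t = n)

/-- **The enlarged switched sequence** as a sifted sequence: weights `switchedWeightT`,
density `g = shiftedPrimesDensity N` (`1/φ(d)` for `(d, N) = 1`, else `0`), size `#T̃(N, ε)`
(Nathanson p. 288: "`g(d) = g_n(d) = 1/φ(d)`", `|B^{(ℓ)}_d| = |B^{(ℓ)}|/φ(d) + r_d^{(ℓ)}`).
[cite: Nathanson1996, Thm 10.6 (proof)] -/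
def switchedSeqT (N : ℕ) (ε : ℝ) : SieveSequence where
  a := switchedWeightT N ε
  a_nonneg := fun _ => Nat.cast_nonneg _
  size := fun _ => #(switchedTriplesT N ε)
  density := shiftedPrimesDensity N
  density_mult := isMultiplicative_shiftedPrimesDensity N

/-- The remainder of the enlarged switched sequence up to level `D`, sifting primes `< y`:
`R(N, ε, D) = ∑_{d < D, d ∣ P(y)} |#{t ∈ T̃ : d ∣ |N − p₁p₂p₃|} − g(d) · #T̃|`
(Nathanson's `∑_ℓ R^{(ℓ)}` dominates it, (10.15)). [cite: Nathanson1996, Thm 10.6 (proof, (10.15))] -/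
def switchedRemainderT (N : ℕ) (ε D : ℝ) : ℝ :=
  ∑ d ∈ (Finset.range ⌈D⌉₊).filter (· ∣ primesProdBelow (y N)),
    |(#((switchedTriplesT N ε).filter fun t : ℕ × ℕ × ℕ => d ∣ tripleDist N t) : ℝ) -
      shiftedPrimesDensity N d * #(switchedTriplesT N ε)|

/-- `R(N, ε, D) ≥ 0`. [folklore] -/
theorem switchedRemainderT_nonneg (N : ℕ) (ε D : ℝ) : 0 ≤ switchedRemainderT N ε D :=
  Finset.sum_nonneg fun _ _ => abs_nonneg _

/-- `∑_{n ∈ S} a(n) = #{t ∈ T̃ : |N − p₁p₂p₃| ∈ S}`. [folklore] -/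
theorem sum_switchedWeightT_eq (N : ℕ) (ε : ℝ) (S : Finset ℕ) :
    ∑ n ∈ S, switchedWeightT N ε n =
      #((switchedTriplesT N ε).filter fun t : ℕ × ℕ × ℕ => tripleDist N t ∈ S) := by
  unfold switchedWeightT
  exact sum_card_filter_eq_card_filter_mem _ _ _

/-- `S(𝒜̃, P; N) = #{t ∈ T̃ : (|N − p₁p₂p₃|, P) = 1}` (every `|N − p₁p₂p₃|` lies in `(0, N]`).
[folklore] -/
theorem sifted_switchedSeqT_eq {N : ℕ} {ε : ℝ} (hε : 0 < ε) (hε1 : ε ≤ 1) (P : ℕ) :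
    (switchedSeqT N ε).sifted N P =
      #((switchedTriplesT N ε).filter fun t : ℕ × ℕ × ℕ => (tripleDist N t).Coprime P) := by
  change ∑ n ∈ (Finset.Ioc 0 ⌊((N : ℕ) : ℝ)⌋₊).filter (fun n : ℕ => n.Coprime P),
    switchedWeightT N ε n = _
  rw [Nat.floor_natCast, sum_switchedWeightT_eq]
  congr 2
  refine Finset.filter_congr fun t ht => ?_
  have hb := tripleDist_pos_and_leT hε hε1 ht
  simp only [Finset.mem_filter, Finset.mem_Ioc]
  constructor
  · exact fun h => h.2
  · exact fun h => ⟨⟨by omega, hb.2⟩, h⟩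

/-- `|𝒜̃_d|(N) = #{t ∈ T̃ : d ∣ |N − p₁p₂p₃|}`. [folklore] -/
theorem congrSum_switchedSeqT_eq {N : ℕ} {ε : ℝ} (hε : 0 < ε) (hε1 : ε ≤ 1) (d : ℕ) :
    (switchedSeqT N ε).congrSum d N =
      #((switchedTriplesT N ε).filter fun t : ℕ × ℕ × ℕ => d ∣ tripleDist N t) := by
  change ∑ n ∈ (Finset.Ioc 0 ⌊((N : ℕ) : ℝ)⌋₊).filter (d ∣ ·), switchedWeightT N ε n = _
  rw [Nat.floor_natCast, sum_switchedWeightT_eq]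
  congr 2
  refine Finset.filter_congr fun t ht => ?_
  have hb := tripleDist_pos_and_leT hε hε1 ht
  simp only [Finset.mem_filter, Finset.mem_Ioc]
  constructor
  · exact fun h => h.2
  · exact fun h => ⟨⟨by omega, hb.2⟩, h⟩

/-- The remainder sum of the sieve theorem for `𝒜̃` at height `N` is `R(N, ε, D)`. [folklore] -/
theorem sum_abs_remainder_switchedSeqT_eq {N : ℕ} {ε : ℝ} (hε : 0 < ε) (hε1 : ε ≤ 1) (D : ℝ) :
    ∑ d ∈ (Finset.range ⌈D⌉₊).filter (· ∣ primesProdBelow (y N)),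
        |(switchedSeqT N ε).remainder d N| = switchedRemainderT N ε D := by
  unfold switchedRemainderT
  refine Finset.sum_congr rfl fun d _ => ?_
  rw [SieveSequence.remainder, congrSum_switchedSeqT_eq hε hε1]
  rfl

/-- `V(P(w))` for the density `shiftedPrimesDensity N` is Chen's `V(w) = ∏_{p<w, p∤N}(1 − 1/(p−1))`.
[cite: Nathanson1996, (10.8)] -/
theorem densityProduct_switchedSeqT_eq (N : ℕ) (ε : ℝ) (w : ℝ) :
    (switchedSeqT N ε).densityProduct (primesProdBelow w) = sieveProduct N w :=
  densityProduct_chenGoldbachSeq N w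

/-! ### From `B` to `T̃(N, ε)` -/

/-- **`S(B, 𝒫, y) ≤ S(𝒜̃, P(y); N)`** (Nathanson (10.14): `B ⊆ B̃`): the number of elements of
`B` without prime factors `q < y`, `q ∤ N`, is at most the number of triples `t ∈ T̃(N, ε)` with
`(|N − p₁p₂p₃|, P(y)) = 1` (an element `n = N − p₁p₂p₃` of `B` comes from the triple
`(p₁, p₂, p₃) ∈ T̃`, as `ℓ(p₁) ≤ p₁`; it is coprime to `N`, so free of ALL primes `< y`).
[cite: Nathanson1996, Thm 10.6 (proof, (10.14))] -/
theorem switchedSiftedCount_le_cardT {N : ℕ} {ε : ℝ} (hε : 0 < ε) :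
    switchedSiftedCount N ((N : ℝ) ^ (1 / 10 : ℝ)) (y N) ≤
      #((switchedTriplesT N ε).filter fun t : ℕ × ℕ × ℕ =>
        (tripleDist N t).Coprime (primesProdBelow (y N))) := by
  classical
  unfold switchedSiftedCount
  refine le_trans (Finset.card_le_card (t := ((switchedTriplesT N ε).filter
      fun t : ℕ × ℕ × ℕ => (tripleDist N t).Coprime (primesProdBelow (y N))).image
    fun t : ℕ × ℕ × ℕ => tripleDist N t) ?_) Finset.card_image_le
  intro n hn
  rw [Finset.mem_filter] at hn
  obtain ⟨hnB, hsift⟩ := hn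
  rw [switchedSet, Finset.mem_filter] at hnB
  obtain ⟨hnN, p₁, hp₁, p₂, hp₂, p₃, hp₃, hz, hy, hy', h23, hlt, hcop, hsum⟩ := hnB
  rw [Nat.mem_primesBelow] at hp₁ hp₂ hp₃
  have hNpos : 0 < N := by omega
  rw [Finset.mem_image]
  refine ⟨(p₁, p₂, p₃), ?_, ?_⟩
  · rw [Finset.mem_filter, mem_switchedTriplesT]
    have hcop' := Nat.coprime_mul_iff_left.mp hcop
    have hcop1 : ¬p₁ ∣ N := (Nat.Prime.coprime_iff_not_dvd hp₁.2).mp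
      (Nat.coprime_mul_iff_left.mp hcop'.1).1
    have hcop23 : (p₂ * p₃).Coprime N := by
      rw [Nat.coprime_mul_iff_left]
      exact ⟨(Nat.coprime_mul_iff_left.mp hcop'.1).2, hcop'.2⟩
    have hgrid : chenGridPointT N ε p₁ * p₂ * p₃ < (N : ℝ) := by
      have hℓ := chenGridPointT_le hNpos hε hz
      have hℓ0 := (chenGridPointT_pos hNpos hε p₁).le
      calc chenGridPointT N ε p₁ * p₂ * p₃ ≤ (p₁ : ℝ) * p₂ * p₃ := by gcongr
        _ = ((p₁ * p₂ * p₃ : ℕ) : ℝ) := by push_cast; ring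
        _ < N := by exact_mod_cast hlt
    refine ⟨⟨⟨hp₁.1, hp₂.1, hp₃.1⟩, hp₁.2, hp₂.2, hp₃.2, hz, hy, hy', h23, hcop1, hcop23, hgrid⟩, ?_⟩
    -- coprimality with `P(y)`
    have hdist : tripleDist N (p₁, p₂, p₃) = n := by
      unfold tripleDist
      dsimp only
      have : (N : ℤ) - p₁ * p₂ * p₃ = n := by
        have h := congrArg (fun m : ℕ => (m : ℤ)) hsum
        push_cast at h
        linarith
      rw [this, Int.natAbs_natCast]
    rw [hdist, coprime_primesProdBelow_iff]
    intro q hq hqn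
    have hqprime : q.Prime := Nat.prime_of_mem_primesBelow hq
    by_cases hqN : q ∣ N
    · -- `q ∣ N`, `q ∣ n` ⇒ `q ∣ p₁p₂p₃`, contradicting `(p₁p₂p₃, N) = 1`
      have hqP : q ∣ p₁ * p₂ * p₃ := by
        have : q ∣ p₁ * p₂ * p₃ + n := by rw [hsum]; exact hqN
        exact (Nat.dvd_add_left hqn).mp this
      have hg : q ∣ Nat.gcd (p₁ * p₂ * p₃) N := Nat.dvd_gcd hqP hqN
      rw [hcop.gcd_eq_one] at hg
      exact absurd (Nat.dvd_one.mp hg) hqprime.one_lt.ne'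
    · exact hsift q hq hqN hqn
  · unfold tripleDist
    dsimp only
    have : (N : ℤ) - p₁ * p₂ * p₃ = n := by
      have h := congrArg (fun m : ℕ => (m : ℤ)) hsum
      push_cast at h
      linarith
    rw [this, Int.natAbs_natCast]

/-! ### The sieve factor tends to its limit -/

/-- For all real `K, C, C₈`, `θ > 0`, `a > 0`, eventually in `N ∈ ℕ`, with
`E = e^{400/log N} (1 + 1/(N^{1/8} − 1))⁸ · (1 + |C₈|/log N)/(1 − 1170/log N)`:
`E K + (3/8) E C (a log N)^{−1/3} ≤ K + θ`. [folklore] -/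
theorem eventually_switchedSieveFactorT_le (K C C₈ : ℝ) {θ a : ℝ} (hθ : 0 < θ) (ha : 0 < a) :
    ∀ᶠ N : ℕ in atTop,
      Real.exp (400 / Real.log N) * (1 + 1 / ((N : ℝ) ^ (1 / 8 : ℝ) - 1)) ^ 8 *
            ((1 + |C₈| / Real.log N) / (1 - 1170 / Real.log N)) * K +
        3 / 8 * (Real.exp (400 / Real.log N) * (1 + 1 / ((N : ℝ) ^ (1 / 8 : ℝ) - 1)) ^ 8 *
            ((1 + |C₈| / Real.log N) / (1 - 1170 / Real.log N))) * C *
          (a * Real.log N) ^ (-(1 / 3 : ℝ)) ≤ K + θ := by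
  have h1 : Tendsto (fun X : ℝ => 400 / Real.log X) atTop (𝓝 0) :=
    tendsto_const_nhds.div_atTop Real.tendsto_log_atTop
  have h2 : Tendsto (fun X : ℝ => Real.exp (400 / Real.log X)) atTop (𝓝 1) := by
    have h := (Real.continuous_exp.tendsto 0).comp h1
    rw [Real.exp_zero] at h
    exact h
  have h3 : Tendsto (fun X : ℝ => (a * Real.log X) ^ (-(1 / 3 : ℝ))) atTop (𝓝 0) :=
    (tendsto_rpow_neg_atTop (by norm_num : (0 : ℝ) < 1 / 3)).comp
      (Real.tendsto_log_atTop.const_mul_atTop ha)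
  have h4 : Tendsto (fun X : ℝ => (1 + 1 / (X ^ (1 / 8 : ℝ) - 1)) ^ 8) atTop (𝓝 ((1 + 0) ^ 8)) := by
    refine ((tendsto_const_nhds.add ?_).pow 8)
    have h := (tendsto_rpow_atTop (by norm_num : (0 : ℝ) < 1 / 8))
    have h' : Tendsto (fun X : ℝ => X ^ (1 / 8 : ℝ) - 1) atTop atTop :=
      tendsto_atTop_add_const_right _ (-1) h
    have h'' := h'.inv_tendsto_atTop
    refine h''.congr fun X => ?_
    simp only [Pi.inv_apply, one_div]
  simp only [add_zero, one_pow] at h4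
  have hρ : Tendsto (fun X : ℝ => (1 + |C₈| / Real.log X) / (1 - 1170 / Real.log X)) atTop
      (𝓝 ((1 + 0) / (1 - 0))) := by
    refine Tendsto.div (tendsto_const_nhds.add ?_) (tendsto_const_nhds.sub ?_) (by norm_num)
    · exact tendsto_const_nhds.div_atTop Real.tendsto_log_atTop
    · exact tendsto_const_nhds.div_atTop Real.tendsto_log_atTop
  simp only [add_zero, sub_zero, div_one] at hρ
  have h5 : Tendsto (fun X : ℝ => Real.exp (400 / Real.log X) * (1 + 1 / (X ^ (1 / 8 : ℝ) - 1)) ^ 8 *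
      ((1 + |C₈| / Real.log X) / (1 - 1170 / Real.log X))) atTop (𝓝 (1 * 1 * 1)) := (h2.mul h4).mul hρ
  rw [one_mul, one_mul] at h5
  have h6 : Tendsto (fun X : ℝ =>
      Real.exp (400 / Real.log X) * (1 + 1 / (X ^ (1 / 8 : ℝ) - 1)) ^ 8 *
            ((1 + |C₈| / Real.log X) / (1 - 1170 / Real.log X)) * K +
        3 / 8 * (Real.exp (400 / Real.log X) * (1 + 1 / (X ^ (1 / 8 : ℝ) - 1)) ^ 8 *
            ((1 + |C₈| / Real.log X) / (1 - 1170 / Real.log X))) * C *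
          (a * Real.log X) ^ (-(1 / 3 : ℝ))) atTop (𝓝 (1 * K + 3 / 8 * 1 * C * 0)) :=
    (h5.mul_const K).add (((h5.const_mul (3 / 8)).mul_const C).mul h3)
  simp only [one_mul, mul_one, mul_zero, add_zero] at h6
  have h7 := h6.comp tendsto_natCast_atTop_atTop
  have h8 := h7.eventually_le_const (show K < K + θ by linarith)
  filter_upwards [h8] with N hN
  simpa using hN

/-! ### The sieve step -/

set_option maxHeartbeats 800000 in
/-- **The sieve step of the switching bound at `z = N^{1/10}`** (Chen's Lemma 8 / Nathanson's
Theorem 10.6, pp. 288–289, for `B = {N − p₁p₂p₃ : N^{1/10} ≤ p₁ < N^{1/3} ≤ p₂ ≤ p₃}`): for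
`0 < ε ≤ 1`, `0 < δ ≤ 1/8`, `θ > 0` and all large even `N`, with `y = N^{1/3}`, `V = sieveProduct N`,

`S(B, 𝒫, y) ≤ (2e^γ/(5(1 − 2δ)) + θ) · #T̃(N, ε) · V(N^{1/10}) + R(N, ε, N^{1/2−δ})`.

Proof: `S(B, 𝒫, y) ≤ S(𝒜̃, P(y); N)` (`B ⊆ B̃`); the uniform linear-sieve upper bound
(`LinearSieve.upper_explicit`, level `D = N^{1/2−δ}`) gives
`S ≤ #T̃ · V(y) (2e^γ/s + C(log D)^{−1/3}) + R`, `s = log D/log y = 3(1/2 − δ)`; and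
`V(y) ≤ (3/8) E₈ V(N^{1/8})` (`sieveProduct_le_mul_of_le`), `V(N^{1/8}) ≤ (4/5) ρ_N V(N^{1/10})`
(the Mertens estimates at `N^{1/8}` and `N^{1/10}`: `16 e^{−γ}𝔖(N)/log N` resp. `20 e^{−γ}𝔖(N)/log N`),
with `E₈ ρ_N → 1`, so `V(y) · 2e^γ/s ≤ (3/10) E (2e^γ/3)/(1/2 − δ) V(N^{1/10}) = E · 2e^γ/(5(1−2δ)) V(N^{1/10})`.
[cite: ChenSciSinica1973, Lemma 8 (27)] -/
theorem switchedSiftedCount_leT {ε δ θ : ℝ} (hε : 0 < ε) (hε1 : ε ≤ 1) (hδ : 0 < δ)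
    (hδ1 : δ ≤ 1 / 8) (hθ : 0 < θ) :
    ∀ᶠ N : ℕ in atTop, Even N →
      (switchedSiftedCount N ((N : ℝ) ^ (1 / 10 : ℝ)) (y N) : ℝ) ≤
        (2 * Real.exp Real.eulerMascheroniConstant / (5 * (1 - 2 * δ)) + θ) *
            #(switchedTriplesT N ε) * sieveProduct N ((N : ℝ) ^ (1 / 10 : ℝ)) +
          switchedRemainderT N ε ((N : ℝ) ^ (1 / 2 - δ)) := by
  -- the uniform linear sieve, for the dimension class `Ω(1, L₀)`
  obtain ⟨CI, hCI⟩ := LinearSieve.upper_explicit (54 * Real.exp (54 / Real.log 2))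
  -- Mertens at `N^{1/8}`
  obtain ⟨C₈, N₈, hV8⟩ := chen_sieveProduct_estimate_holds
  set G := Real.exp Real.eulerMascheroniConstant with hG
  have hG0 : 0 < G := Real.exp_pos _
  set g' := Real.exp (-Real.eulerMascheroniConstant) with hg'
  have hg'0 : 0 < g' := Real.exp_pos _
  set K := 2 * G / (5 * (1 - 2 * δ)) with hK
  have h12δ : 0 < 1 - 2 * δ := by linarith
  have hK0 : 0 ≤ K := by positivity
  have ha : 0 < 1 / 2 - δ := by linarith
  have hlog : Tendsto (fun N : ℕ => Real.log N) atTop atTop :=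
    Real.tendsto_log_atTop.comp (tendsto_natCast_atTop_atTop (R := ℝ))
  filter_upwards [eventually_ge_atTop (3 ^ 8), eventually_ge_atTop N₈,
    hlog.eventually_ge_atTop (max 500 (2 * 1170 + 2 * |C₈|)),
    eventually_switchedSieveFactorT_le K (max CI 0) C₈ hθ ha] with N hN hN₈ hL hfac hEven
  -- basic quantities
  have hNpos : 0 < N := by omega
  have hN0 : N ≠ 0 := by omega
  have hN1 : (1 : ℝ) < N := by exact_mod_cast (show 1 < N by omega)
  have hN0' : (0 : ℝ) < N := by linarith
  have hlogN : 0 < Real.log N := Real.log_pos hN1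
  set L := Real.log N with hLdef
  have hL500 : 500 ≤ L := le_trans (le_max_left _ _) hL
  have hL2 : 2 * 1170 + 2 * |C₈| ≤ L := le_trans (le_max_right _ _) hL
  set zr : ℝ := z N with hzr
  have hzr_def : zr = (N : ℝ) ^ (1 / 8 : ℝ) := rfl
  have hzr3 : 3 ≤ zr := by
    rw [hzr_def, show (3 : ℝ) = ((3 : ℝ) ^ (8 : ℕ)) ^ (1 / 8 : ℝ) by
      rw [← Real.rpow_natCast, ← Real.rpow_mul (by norm_num)]; norm_num]
    exact Real.rpow_le_rpow (by norm_num) (by exact_mod_cast hN) (by norm_num)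
  have hzr2 : 2 ≤ zr := by linarith
  have hlogzr : Real.log zr = 1 / 8 * L := Real.log_rpow hN0' _
  have hz8 : (N : ℝ) ≤ zr ^ 8 := by
    rw [hzr_def, ← Real.rpow_natCast, ← Real.rpow_mul hN0'.le]
    norm_num
  set z10 : ℝ := (N : ℝ) ^ (1 / 10 : ℝ) with hz10
  have hlogz10 : Real.log z10 = 1 / 10 * L := Real.log_rpow hN0' _
  set Y : ℝ := y N with hY
  have hY_def : Y = (N : ℝ) ^ (1 / 3 : ℝ) := rfl
  have hzY : zr ≤ Y := Real.rpow_le_rpow_of_exponent_le hN1.le (by norm_num)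
  have hY2 : 2 ≤ Y := by linarith
  have hlogY : Real.log Y = 1 / 3 * L := Real.log_rpow hN0' _
  have hlogY0 : 0 < Real.log Y := by rw [hlogY]; positivity
  set D : ℝ := (N : ℝ) ^ (1 / 2 - δ) with hD
  have hlogD : Real.log D = (1 / 2 - δ) * L := Real.log_rpow hN0' _
  have hlogD0 : 0 < Real.log D := by rw [hlogD]; positivity
  have hYD : Y ≤ D := Real.rpow_le_rpow_of_exponent_le hN1.le (by linarith)
  have hs3 : Real.log D / Real.log Y ≤ 3 := by
    rw [div_le_iff₀ hlogY0, hlogD, hlogY]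
    nlinarith [mul_nonneg hδ.le hlogN.le]
  -- the sieve inequality for `𝒜̃`
  set A := switchedSeqT N ε with hA
  have hdim : HasIwaniecDimension A.density 1 (54 * Real.exp (54 / Real.log 2)) :=
    hasIwaniecDimension_shiftedPrimesDensity hEven
  have hsize : (0 : ℝ) ≤ A.size N := Nat.cast_nonneg _
  have hI := hCI A hdim N D Y hY2 hYD hs3 hsize
  -- identify the terms
  have hsift : (switchedSiftedCount N z10 (y N) : ℝ) ≤ A.sifted N (primesProdBelow Y) := by
    rw [hA, hY, sifted_switchedSeqT_eq hε hε1]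
    exact_mod_cast switchedSiftedCount_le_cardT hε
  have hsizeq : A.size N = #(switchedTriplesT N ε) := rfl
  have hVq : A.densityProduct (primesProdBelow Y) = sieveProduct N Y :=
    densityProduct_switchedSeqT_eq N ε Y
  have hRq : ∑ d ∈ (Finset.range ⌈D⌉₊).filter (· ∣ primesProdBelow Y), |A.remainder d N| =
      switchedRemainderT N ε D := by
    rw [hA, hY]
    exact sum_abs_remainder_switchedSeqT_eq hε hε1 D
  rw [hsizeq, hVq, hRq, hlogD] at hI
  -- the main term
  have hT0 : 0 ≤ (#(switchedTriplesT N ε) : ℝ) := Nat.cast_nonneg _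
  have hVy0 : 0 ≤ sieveProduct N Y := (sieveProduct_mem_Icc hEven Y).1
  have hVz0 : 0 ≤ sieveProduct N z10 := (sieveProduct_mem_Icc hEven z10).1
  set ρN : ℝ := (1 + |C₈| / L) / (1 - 1170 / L) with hρN
  have hden : 0 < 1 - 1170 / L := by
    rw [sub_pos, div_lt_one hlogN]; linarith [abs_nonneg C₈]
  have hρN0 : 0 ≤ ρN := by positivity
  set E : ℝ := Real.exp (400 / L) * (1 + 1 / ((N : ℝ) ^ (1 / 8 : ℝ) - 1)) ^ 8 * ρN with hE
  have hE0 : 0 ≤ E := by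
    have : 0 ≤ 1 / ((N : ℝ) ^ (1 / 8 : ℝ) - 1) := by
      rw [← hzr_def]; exact div_nonneg zero_le_one (by linarith)
    positivity
  -- `V(Y) ≤ V(zr) (3/8) E₈`
  have hVyle8 : sieveProduct N Y ≤ sieveProduct N zr *
      (1 / 8 * L / Real.log Y * (Real.exp (400 / L) * (1 + 1 / ((N : ℝ) ^ (1 / 8 : ℝ) - 1)) ^ 8)) := by
    have h := sieveProduct_le_mul_of_le hEven hN0 hzr2 hzY hz8
    rw [hlogzr] at h
    have h50 : (50 : ℝ) / (1 / 8 * L) = 400 / L := by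
      rw [div_mul_eq_div_div]
      norm_num
    rw [h50] at h
    refine h.trans (le_of_eq ?_)
    rw [hzr_def]
    ring
  -- `V(zr) ≤ (4/5) ρN V(z10)` from the two Mertens estimates
  have hS0 : 0 < singularSeries N := singularSeries_pos N
  have hV8N := hV8 N hN₈ hEven
  have hV10N := sieveProduct_tenth_estimate (N := N) hL500 hEven
  rw [hlogzr] at hV8N
  rw [hlogz10] at hV10N
  set M10 := 2 * singularSeries N * g' / (1 / 10 * L) with hM10
  have hM10pos : 0 < M10 := by positivity
  have hM8 : 2 * singularSeries N * g' / (1 / 8 * L) = 4 / 5 * M10 := by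
    rw [hM10]; field_simp; ring
  rw [hM8] at hV8N
  have hVzr_le : sieveProduct N zr ≤ 4 / 5 * M10 * (1 + |C₈| / L) := by
    have h1 := (abs_sub_le_iff.mp hV8N).1
    have h2 : C₈ * (4 / 5 * M10) / L ≤ |C₈| * (4 / 5 * M10) / L := by
      apply div_le_div_of_nonneg_right _ hlogN.le
      exact mul_le_mul_of_nonneg_right (le_abs_self _) (by positivity)
    have e : 4 / 5 * M10 * (1 + |C₈| / L) = 4 / 5 * M10 + |C₈| * (4 / 5 * M10) / L := by
      field_simp
    rw [e]
    change sieveProduct N (z N) ≤ _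
    linarith
  have hVz10_ge : M10 * (1 - 1170 / L) ≤ sieveProduct N z10 := by
    have h1 := (abs_sub_le_iff.mp hV10N).2
    have e : M10 * (1 - 1170 / L) = M10 - 1170 * M10 / L := by field_simp
    rw [e]
    linarith
  have hVzr : sieveProduct N zr ≤ sieveProduct N z10 * (4 / 5 * ρN) := by
    have h1 : M10 ≤ sieveProduct N z10 / (1 - 1170 / L) := by
      rw [le_div_iff₀ hden]; exact hVz10_ge
    calc sieveProduct N zr ≤ 4 / 5 * M10 * (1 + |C₈| / L) := hVzr_le
      _ ≤ 4 / 5 * (sieveProduct N z10 / (1 - 1170 / L)) * (1 + |C₈| / L) := by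
          gcongr
      _ = sieveProduct N z10 * (4 / 5 * ρN) := by rw [hρN]; field_simp
  have hρle : (3 / 10 : ℝ) ≤ 3 / 8 := by norm_num
  have hVyle : sieveProduct N Y ≤ sieveProduct N z10 * (3 / 10 * E) := by
    have hfac8 : 0 ≤ 1 / 8 * L / Real.log Y *
        (Real.exp (400 / L) * (1 + 1 / ((N : ℝ) ^ (1 / 8 : ℝ) - 1)) ^ 8) := by
      have : 0 ≤ 1 / ((N : ℝ) ^ (1 / 8 : ℝ) - 1) := by
        rw [← hzr_def]; exact div_nonneg zero_le_one (by linarith)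
      positivity
    have hρ8 : 1 / 8 * L / Real.log Y = 3 / 8 := by rw [hlogY]; field_simp
    calc sieveProduct N Y ≤ sieveProduct N zr *
          (1 / 8 * L / Real.log Y * (Real.exp (400 / L) * (1 + 1 / ((N : ℝ) ^ (1 / 8 : ℝ) - 1)) ^ 8)) :=
          hVyle8
      _ ≤ sieveProduct N z10 * (4 / 5 * ρN) *
          (1 / 8 * L / Real.log Y * (Real.exp (400 / L) * (1 + 1 / ((N : ℝ) ^ (1 / 8 : ℝ) - 1)) ^ 8)) :=
          mul_le_mul_of_nonneg_right hVzr hfac8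
      _ = sieveProduct N z10 * (3 / 10 * E) := by rw [hρ8, hE]; ring
  have hr0 : 0 ≤ ((1 / 2 - δ) * L) ^ (-(1 / 3 : ℝ)) := Real.rpow_nonneg (by positivity) _
  have hF0 : 0 ≤ 2 * G / ((1 / 2 - δ) * L / Real.log Y) := by positivity
  have hρF : 3 / 10 * (2 * G / ((1 / 2 - δ) * L / Real.log Y)) = K := by
    rw [hK, hlogY]
    field_simp
    ring
  have hmain := sieve_mainTerm_algebra (C := CI) hT0 hVz0 hVy0 hE0 hρle hr0 hF0 hVyle hρF hfac
  -- conclude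
  calc (switchedSiftedCount N z10 (y N) : ℝ) ≤ A.sifted N (primesProdBelow Y) := hsift
    _ ≤ (#(switchedTriplesT N ε) : ℝ) * sieveProduct N Y *
          (2 * G / ((1 / 2 - δ) * L / Real.log Y) +
            CI * ((1 / 2 - δ) * L) ^ (-(1 / 3 : ℝ))) + switchedRemainderT N ε D := hI
    _ ≤ (#(switchedTriplesT N ε) : ℝ) * sieveProduct N z10 * (K + θ) +
          switchedRemainderT N ε D := by linarith
    _ = (K + θ) * #(switchedTriplesT N ε) * sieveProduct N z10 + switchedRemainderT N ε D := by
        ring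

end Literature.NumberTheory.Sieve.Chen
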